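import Summits.QuantumFields.YangMills.Theorems.UnitScaleTiltProp7TJRowOfColumns
import HarnessLib

/-!
# «TJ-DIV DOOR» — the covariant DIVERGENCE row of print's J-term operator `T_Jᴾ(U₀)` ([Balaban1985BackgroundPropagators] (3.127)–(3.128), (3.134)–(3.137)) at a T³ member,
# `‖(D*_{U₀} T_Jᴾ X)(x)‖ ≤ 2·α·ΘH·qG·sup‖X‖` (L-only), FROM the display's `ℓ¹`-column of print's `H` (`hHcol`, ⟸ `h133`) AND ONE «gauge-spike» local-Hessian row `hqG` — by the
# SAME duality as ✓`Prop7TJRowOfColumns.norm_TJP_apply_le_of_columns`, tested against the pure-gauge spike `D_{U₀}(toL2S(δ_x ⊗ A))` instead of the bond spike `toL2(δ_bd ⊗ A)`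

Cell `ym3-torus` (HUMAN RULING D-0037, YM ladder rung R3 — SU(2) YM₃ on T³: NOT d = 4, NOT infinite volume, NOT a mass gap, NOT Clay).  Width seat `ym3-torus-px19` (gen 14, explicit-unit
helper «width 19»); chair ★`ym-ust-19200-p1` g27 WORD №28 (norm_G road N6, item 5 ∕ the «divergence row of T_J» shortcut; px19 g14 LOCATE-N6 = 19200 evidence #50, SHORTCUT LOCATE
2026-08-30T09:49Z).  THEOREMS ONLY (0 `def`, 0 `sorry`, default heartbeats); `--supports stmt-QuantumFields-19200 --as helper`; count-neutral; NO claim on crux ∕ stub ∕ registry.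

THE PRINT.  [Balaban1985BackgroundPropagators] p. 421 (3.127)–(3.128) (the J-term `−2⟨HC⁽²⁾(A), J⟩` of `Δ₁`); p. 422 (3.134)–(3.136) (`⟨A, Δ⁽²⁾A⟩ = 2⟨HC⁽²⁾(A), J⟩`, `Δ⁽²⁾_π = Δ⁽²⁾ −
DRG′D*Δ⁽²⁾ − Δ⁽²⁾DG′RD* + DRG′D*Δ⁽²⁾DG′RD*`); p. 423 (3.137) «|(Δ⁽²⁾A)(b)| ≤ O(1)Mα₀(Lʲη)⁻²|A|» and lines 1–9: «derivatives in the operator Δ′_π + Δ⁽²⁾_π which have to be applied either to the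
operator on the right, or on the left, because kernels of the operators defining Δ′_π + Δ⁽²⁾_π are not regular enough» (print then pays with the Hölder members (3.43)–(3.45)); p. 418
(3.114)–(3.115) «Q_j(D_Uλ) = D_{U_j}(Q′_jλ)» (gauge covariance of the averaging — the REASON a pure-gauge spike-gradient of size `η⁻¹` costs like a spike of size `1` in `C⁽²⁾`).

WHY (LOCATE-N6 §3, SHORTCUT LOCATE).  In norm_G's road the sandwich `Pᴾ†T_JPᴾ` (`Pᴾ = 1 − DG′ᴾR_SD*`) puts `D*_{U₀}` on the lattice-rough bounded field `T_Jᴾy`; the GENERIC bound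
`‖D*(T_Jy)‖_∞ ≤ 2d·η⁻¹·‖T_J‖_{∞→∞}‖y‖` loses `ℓ = η⁻¹` (tested against the (q)-row of ✓`norm_TJP_apply_le_of_columns`: `(2∕η²)(η³α)(ηΘHℓ³)(qAℓ⁻¹·η⁻¹) = 2αΘHqA·ℓ`).  The gauge covariance of
`C⁽²⁾ = avgHess` says more: the column of `avgHess` against the pure-gauge spike `D_{U₀}(δ_x ⊗ A)` has the size of a column against a spike of size `‖A‖`, NOT `η⁻¹‖A‖` — the row `hqG`
below (supplier currency `qG·(L^{K−n})⁻¹`, exactly (q)'s; to be DISCHARGED from the second-order twin of ✓`Prop7SymAvgTwSGaugeDir.QTwS_gaugeDir_of_avgSeq`).  With it the divergence row is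
L-only, `R_SG′ᴾD*(T_Jy) = R_SG′ᴾ(bounded)` needs no «G′∇*» letter, and the scalar `R_SG′ᴾD*(T_Jy)` has a bounded covariant gradient — the Hölder members leave norm_G's `T_J` word.

THE MATHEMATICS (duality over landed letters; no propagator theory).  With `v := D*_{U₀}(T_Jᴾ(toL2 X))`, `A := (toL2S⁻¹ v)(x)`, `w := toL2S(δ_x ⊗ A)`: `⟪v, w⟫ = ‖w‖² ≥ c₀‖A‖²`
(✓`inner_toL2S`, ✓`norm_sq_toL2S`, lit ✓`MatrixNorms.opNorm_sq_le_sum_norm_sq`); `⟪v, w⟫ = ⟪T_Jᴾ(toL2 X), D_{U₀}w⟫` (✓`adjoint_DL2`) `= (2c₀∕η²)·actionGrad U₀ (H46P U₀ (avgHess U₀ Xᴴ X′))`,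
`X′ := toL2⁻¹(D_{U₀} w)` (✓`inner_TJP_left` ∕ ✓`tjSesqP_apply` ∕ ✓`tjFormP_apply`); then (J) `‖actionGrad U₀ Z‖ ≤ cJ·Σ‖Z b‖`, (H) `Σ_b‖H46P U₀ B b‖ ≤ θ·Σ_y‖B y‖`, (qG)
`Σ_y‖avgHess U₀ X̃ X′ y‖ ≤ qG·sup‖X̃‖·‖A‖` give `c₀‖A‖² ≤ (2c₀∕η²)·cJ·θ·qG·s·‖A‖`.  Dimension line at `U₀ ∈ 𝔘_k(α)` (✓`norm_actionGrad_le_of_regPr`: `cJ = η³α`; ✓`sum_norm_H46P_le_of_column`: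
`θ = η·ΘH·ℓ³`; supplier `qG·ℓ⁻¹`): `(2∕η²)(η³α)(ηΘHℓ³)(qGℓ⁻¹) = 2αΘHqG` since `ℓη = 1`.

WHAT IS PROVED (ns `…Theorems.Prop7TJDivRowOfColumns`; member `F`, `h : n ≤ K`, weights `c₀ cB a`, background `U₀`).
* §1 `c0_mul_norm_sq_le_norm_sq_toL2S_single` (`c₀‖A‖² ≤ ‖toL2S(δ_x ⊗ A)‖²`), `inner_toL2S_eq_inner_single_of_apply_eq` (the spike test `⟪toL2S g, toL2S(δ_x ⊗ g x)⟫ = ‖toL2S(δ_x ⊗ g x)‖²`).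
* §2 ★★ `norm_DstarL2_TJP_apply_le_of_columns` — the member door from (J)(H)(qG), constant `(2∕η²)·cJ·θ·qG`.
* §3 ★★ `tjDivRow_of_regPr_column` — at `RegPr ρ U₀` from `hHcol`'s majorant (`hcol`, `hsum`, total `Θ`) and (qG), constant `2·ρ·Θ·qG·η²`.
* §4 ★★★ `hTJdiv_of_hHcol_hqG` — the family door: for every `L > 1`, `i : Idx L`, `U₀ ∈ 𝔘_k(α L)`, every exponent field `X` with `sup‖X‖ ≤ s` and every site `x`:
  `‖(toL2S⁻¹(D*_{U₀}(T_Jᴾ(toL2 X))))(x)‖ ≤ 2·α L·ΘH L·qG L·s`, from the display's `hHcol` VERBATIM (S20ᴸ ✓p690345 :143–146 text; ⟸ `h133` by ✓`Prop7ColumnRowsOfKernelDecay.hHcol_of_kernel133_family`)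
  and the gauge-spike row `hqG` (DISPLAYED; supplier = the second-order gauge covariance of `logChartTwS`).
HYP-SAT (★★OWNER RULING №42): (J) is a theorem at `RegPr`; `hHcol` is the display's own row (inhabited shape: `hk ≥ 0` with finite column sums); `hqG` is a real-inequality schema over all bounded
fields and all site spikes (tested at `X̃ = 0`, `A = 0` it forces only `0 ≤ qG` — non-vacuous, no `Prop` placeholder); conclusions are pointwise bounds for the row's own operator.
HONEST SCOPE.  Norm ∕ duality bookkeeping; CONDITIONAL on `hHcol` ([B9] Thm 3.12 (3.133) class, N06) and on `hqG` (NOT proved here); nothing of `hqG`, the gauge-covariance identity, (3.137),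
the 8 EX rows, `hThm2S`, EX, the crux or rung R3 is proved; the Yang–Mills mass gap is NOT proved.

References: T. Bałaban, CMP **99** (1985) 389–434 [Balaban1985BackgroundPropagators] ((3.11)–(3.14) pp.392–393, (3.114)–(3.115) p.418, (3.126)–(3.128) pp.420–421, (3.133)–(3.137)
pp.422–423); CMP **102** (1985) 277–309 [Balaban1985Variational] ((27)–(28) p.282, (115) p.294); CMP **98** (1985) 17–51 [Balaban1985Averaging] (Prop. 5 (157) p.42).
-/

set_option autoImplicit false

noncomputable section

open scoped InnerProductSpace ComplexConjugate Matrix.Norms.L2Operator BigOperators Matrix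

namespace Summit.QuantumFields.YangMills.Theorems.Prop7TJDivRowOfColumns

open Literature.MathematicalPhysics.QuantumFieldTheory.Balaban1983to89
open Literature.MathematicalPhysics.QuantumFieldTheory.Balaban1983to89.T3ContinuumYM3Torus
open Literature.MathematicalPhysics.QuantumFieldTheory.Balaban1983to89.T3Thm1Carrier (Idx)
open T3SectALandauChart (eta eta_pos)
open T3PrintedRegularMinimiser (RegPr)
open B9SectCLatticeCarrier (Bond)
open B9Eq311L2Pairing (WL2)
open B11Eq103H1Complex (SiteL2K BondL2K)
open B11Eq90V0primeCurrent (flat115)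
open Summit.QuantumFields.YangMills.Theorems.Prop7SectET3Transport (periodsT3)
open Summit.QuantumFields.YangMills.Theorems.Prop7SectET3HilbertLetters (W₂ toL2 toL2S DL2 DstarL2 adjoint_DL2)
open Summit.QuantumFields.YangMills.Theorems.Prop7SectET3CurvedPropagators (H1f)
open Summit.QuantumFields.YangMills.Theorems.Prop7SectET3DeltaPiPInv (DeltaPiSlotP H46P)
open Summit.QuantumFields.YangMills.Theorems.Prop7SectET3DeltaOne (actionGrad avgHess)
open Summit.QuantumFields.YangMills.Theorems.Prop7SectET3DeltaOnePInv (TJP TJSlotP tjFormP_apply tjSesqP_apply inner_TJP_left TJSlotP_apply)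
open Summit.QuantumFields.YangMills.Theorems.Prop7SectET3RealCoordSums (inner_toL2S)
open Summit.QuantumFields.YangMills.Theorems.Prop7LaplaceAFlatLetters (norm_sq_toL2S)
open Summit.QuantumFields.YangMills.Theorems.Prop7TJRowOfColumns (norm_star_apply_le norm_actionGrad_le_of_regPr sum_norm_H46P_le_of_column)

variable {F : T3Family} {n K : ℕ} {h : n ≤ K} {c₀ cB a : ℝ} [Fact (0 < c₀)] [Fact (0 < cB)]

/-! ## §1 Two spike letters in the weighted `L²` of the gauge parameters -/

/-- `c₀·‖A‖² ≤ ‖toL2S(δ_x ⊗ A)‖²` — the `L²`-operator norm of a matrix is at most its Hilbert–Schmidt norm (lit ✓`MatrixNorms.opNorm_sq_le_sum_norm_sq`), read through ✓`norm_sq_toL2S`.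
[cite: Balaban1985BackgroundPropagators, (3.11) p.392] -/
theorem c0_mul_norm_sq_le_norm_sq_toL2S_single (x : Site (F.P K) 0) (A : Matrix (Fin 2) (Fin 2) ℂ) :
    c₀ * ‖A‖ ^ 2 ≤ ‖toL2S F K c₀ (Pi.single x A)‖ ^ 2 := by
  have hc : 0 ≤ c₀ := (Fact.out : 0 < c₀).le
  rw [norm_sq_toL2S, Finset.sum_eq_single x (fun z _ hz => by simp [Pi.single_eq_of_ne hz]) (fun hx => (hx (Finset.mem_univ x)).elim),
    Pi.single_eq_same]
  exact mul_le_mul_of_nonneg_left (MatrixNorms.opNorm_sq_le_sum_norm_sq A) hc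

/-- THE SPIKE TEST: `⟪toL2S g, toL2S(δ_x ⊗ g x)⟫ = ⟪toL2S(δ_x ⊗ g x), toL2S(δ_x ⊗ g x)⟫` (both are `c₀·tr((g x)ᴴ·g x)` by ✓`inner_toL2S`). [cite: Balaban1985BackgroundPropagators, (3.11) p.392] -/
theorem inner_toL2S_eq_inner_single_of_apply_eq (g : Site (F.P K) 0 → Matrix (Fin 2) (Fin 2) ℂ) (x : Site (F.P K) 0) :
    ⟪toL2S F K c₀ g, toL2S F K c₀ (Pi.single x (g x))⟫_ℂ = ⟪toL2S F K c₀ (Pi.single x (g x)), toL2S F K c₀ (Pi.single x (g x))⟫_ℂ := by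
  rw [inner_toL2S, inner_toL2S]
  refine congrArg (fun z : ℂ => (c₀ : ℂ) * z) (Finset.sum_congr rfl fun z _ => ?_)
  by_cases hz : z = x
  · subst hz; rw [Pi.single_eq_same]
  · rw [Pi.single_eq_of_ne hz, Matrix.mul_zero, Matrix.conjTranspose_zero, Matrix.zero_mul]

/-! ## §2 The member door: the divergence row of `T_Jᴾ(U₀)` from (J)(H)(qG) by duality against a pure-gauge spike -/

/-- ★★ **THE DIVERGENCE ROW OF `T_Jᴾ(U₀)` FROM THE THREE COLUMN ROWS** (J) `‖actionGrad U₀ Z‖ ≤ cJ·Σ_b‖Z b‖`, (H) `Σ_b‖H46P U₀ B b‖ ≤ θ·Σ_y‖B y‖`, (qG)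
`Σ_y‖avgHess U₀ X̃ (toL2⁻¹(D_{U₀}(toL2S(δ_x ⊗ A)))) y‖ ≤ qG·s̃·‖A‖` (`sup‖X̃‖ ≤ s̃`): **`‖(toL2S⁻¹ D*_{U₀} T_Jᴾ(U₀) toL2 X)(x)‖ ≤ (2∕η²)·cJ·θ·qG·s`** whenever `sup_b‖X b‖ ≤ s` — by testing
`⟪D*_{U₀}T_Jᴾ toL2 X, toL2S(δ_x ⊗ A)⟫ = ⟪T_Jᴾ toL2 X, D_{U₀}toL2S(δ_x ⊗ A)⟫ = (2c₀∕η²)·actionGrad(H46P(avgHess Xᴴ X′))` at `A := (toL2S⁻¹ D* T_Jᴾ toL2 X)(x)` and `c₀‖A‖² ≤ ‖toL2S(δ_x ⊗ A)‖²`.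
[cite: Balaban1985BackgroundPropagators, (3.127)–(3.128) p.421, (3.137) p.423, (3.114)–(3.115) p.418, (3.11) p.392] -/
theorem norm_DstarL2_TJP_apply_le_of_columns (U₀ : GaugeField (F.P K) 0 (Matrix.specialUnitaryGroup (Fin 2) ℂ)) {cJ θ qG s : ℝ} (hcJ : 0 ≤ cJ) (hθ : 0 ≤ θ)
    (hqG : 0 ≤ qG) (hs : 0 ≤ s)
    (hJ : ∀ Z : PBond (F.P K) 0 → Matrix (Fin 2) (Fin 2) ℂ, ‖actionGrad F K U₀ Z‖ ≤ cJ * ∑ b : PBond (F.P K) 0, ‖Z b‖)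
    (hH : ∀ B : PBond (F.P n) 0 → Matrix (Fin 2) (Fin 2) ℂ, ∑ bd : PBond (F.P K) 0, ‖H46P F n K h c₀ cB a U₀ B bd‖ ≤ θ * ∑ y : PBond (F.P n) 0, ‖B y‖)
    (hQG : ∀ (X' : PBond (F.P K) 0 → Matrix (Fin 2) (Fin 2) ℂ) (s' : ℝ) (x : Site (F.P K) 0) (A : Matrix (Fin 2) (Fin 2) ℂ), (∀ b, ‖X' b‖ ≤ s') →
      ∑ y : PBond (F.P n) 0, ‖avgHess F n K h U₀ X' ((toL2 F K c₀).symm (DL2 F n K c₀ U₀ (toL2S F K c₀ (Pi.single x A)))) y‖ ≤ qG * s' * ‖A‖)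
    (X : PBond (F.P K) 0 → Matrix (Fin 2) (Fin 2) ℂ) (hX : ∀ b, ‖X b‖ ≤ s) (x : Site (F.P K) 0) :
    ‖(toL2S F K c₀).symm (DstarL2 F n K c₀ U₀ (TJP F n K h c₀ cB a U₀ (toL2 F K c₀ X))) x‖ ≤ 2 / (eta F n K) ^ 2 * cJ * θ * qG * s := by
  have hc₀ : (0 : ℝ) < c₀ := Fact.out
  have hη : 0 < eta F n K := eta_pos F n K
  set v : SiteL2K ℂ 3 (periodsT3 F K) c₀ W₂ := DstarL2 F n K c₀ U₀ (TJP F n K h c₀ cB a U₀ (toL2 F K c₀ X)) with hvdef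
  set g : Site (F.P K) 0 → Matrix (Fin 2) (Fin 2) ℂ := (toL2S F K c₀).symm v with hgdef
  set A : Matrix (Fin 2) (Fin 2) ℂ := g x with hAdef
  set w : SiteL2K ℂ 3 (periodsT3 F K) c₀ W₂ := toL2S F K c₀ (Pi.single x A) with hwdef
  -- (1) `⟪v, w⟫ = ⟪w, w⟫`
  have hvg : v = toL2S F K c₀ g := by rw [hgdef, LinearEquiv.apply_symm_apply]
  have h1 : ⟪v, w⟫_ℂ = ⟪w, w⟫_ℂ := by
    rw [hvg, hwdef, hAdef]
    exact inner_toL2S_eq_inner_single_of_apply_eq g x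
  -- (2) move `D*` across: `⟪D* u, w⟫ = ⟪u, D w⟫`, and read `D w` on the route carrier
  set X' : PBond (F.P K) 0 → Matrix (Fin 2) (Fin 2) ℂ := (toL2 F K c₀).symm (DL2 F n K c₀ U₀ w) with hX'def
  have hDw : DL2 F n K c₀ U₀ w = toL2 F K c₀ X' := by rw [hX'def, LinearEquiv.apply_symm_apply]
  have h2 : ⟪v, w⟫_ℂ = ⟪TJP F n K h c₀ cB a U₀ (toL2 F K c₀ X), toL2 F K c₀ X'⟫_ℂ := by
    rw [hvdef, ← adjoint_DL2, LinearMap.adjoint_inner_left, hDw]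
  -- (3) the pairing through the J-term formula
  have h3 : ⟪v, w⟫_ℂ = ((-(2 * (c₀ : ℂ))) / (((eta F n K : ℝ) : ℂ)) ^ 2) *
      -actionGrad F K U₀ (H46P F n K h c₀ cB a U₀ (avgHess F n K h U₀ (star X) X')) := by
    rw [h2, inner_TJP_left, tjSesqP_apply, tjFormP_apply, LinearEquiv.symm_apply_apply, LinearEquiv.symm_apply_apply]
  -- (4) the upper bound of the pairing from (J)(H)(qG)
  have hXs : ∀ b, ‖(star X) b‖ ≤ s := norm_star_apply_le hX
  have h4 : ‖⟪v, w⟫_ℂ‖ ≤ 2 * c₀ / (eta F n K) ^ 2 * (cJ * (θ * (qG * s * ‖A‖))) := by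
    rw [h3, norm_mul, norm_neg]
    have hcoef : ‖(-(2 * (c₀ : ℂ))) / (((eta F n K : ℝ) : ℂ)) ^ 2‖ = 2 * c₀ / (eta F n K) ^ 2 := by
      rw [norm_div, norm_neg, norm_mul, norm_pow, Complex.norm_real, Complex.norm_real, Real.norm_of_nonneg hc₀.le, Real.norm_of_nonneg hη.le, Complex.norm_ofNat]
    rw [hcoef]
    refine mul_le_mul_of_nonneg_left ?_ (by positivity)
    calc ‖actionGrad F K U₀ (H46P F n K h c₀ cB a U₀ (avgHess F n K h U₀ (star X) X'))‖
        ≤ cJ * ∑ b : PBond (F.P K) 0, ‖H46P F n K h c₀ cB a U₀ (avgHess F n K h U₀ (star X) X') b‖ := hJ _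
      _ ≤ cJ * (θ * ∑ y : PBond (F.P n) 0, ‖avgHess F n K h U₀ (star X) X' y‖) := mul_le_mul_of_nonneg_left (hH _) hcJ
      _ ≤ cJ * (θ * (qG * s * ‖A‖)) := by
          refine mul_le_mul_of_nonneg_left (mul_le_mul_of_nonneg_left ?_ hθ) hcJ
          have hq := hQG (star X) s x A hXs
          rw [← hwdef, ← hX'def] at hq
          exact hq
  -- (5) the lower bound `c₀‖A‖² ≤ ‖w‖² = ‖⟪v, w⟫‖`
  have h5 : c₀ * ‖A‖ ^ 2 ≤ ‖w‖ ^ 2 := by rw [hwdef]; exact c0_mul_norm_sq_le_norm_sq_toL2S_single x A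
  have h6 : ‖⟪v, w⟫_ℂ‖ = ‖w‖ ^ 2 := by
    rw [h1, inner_self_eq_norm_sq_to_K, norm_pow, RCLike.norm_ofReal, abs_norm]
  have h7 : c₀ * ‖A‖ ^ 2 ≤ 2 * c₀ / (eta F n K) ^ 2 * (cJ * (θ * (qG * s * ‖A‖))) := h5.trans (h6 ▸ h4)
  -- (6) divide by `c₀‖A‖`
  have hK : 0 ≤ 2 / (eta F n K) ^ 2 * cJ * θ * qG * s := by positivity
  show ‖A‖ ≤ 2 / (eta F n K) ^ 2 * cJ * θ * qG * s
  by_cases hA0 : ‖A‖ = 0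
  · rw [hA0]; exact hK
  · have hApos : 0 < ‖A‖ := lt_of_le_of_ne (norm_nonneg _) (Ne.symm hA0)
    have h8 : ‖A‖ * (c₀ * ‖A‖) ≤ (2 / (eta F n K) ^ 2 * cJ * θ * qG * s) * (c₀ * ‖A‖) := by
      calc ‖A‖ * (c₀ * ‖A‖) = c₀ * ‖A‖ ^ 2 := by ring
        _ ≤ 2 * c₀ / (eta F n K) ^ 2 * (cJ * (θ * (qG * s * ‖A‖))) := h7
        _ = (2 / (eta F n K) ^ 2 * cJ * θ * qG * s) * (c₀ * ‖A‖) := by ring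
    exact le_of_mul_le_mul_right h8 (by positivity)

/-! ## §3 The member door at `U₀ ∈ 𝔘_k(ρ)` from `hHcol`'s majorant and (qG) -/

/-- ★★ **THE MEMBER DOOR AT `U₀ ∈ 𝔘_k(ρ)`**: from an `hHcol`-shaped column majorant (`hcol`, `hsum` with total `Θ`) and the gauge-spike Hessian row (qG) (constant `qG`), the divergence row of
the J-term slot `TJSlotP` holds with constant `2·ρ·Θ·qG·η²` — (J) by ✓`norm_actionGrad_le_of_regPr` (`cJ := η³ρ`), (H) by ✓`sum_norm_H46P_le_of_column` (`θ := η·Θ`).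
[cite: Balaban1985BackgroundPropagators, (3.127)–(3.128) p.421, (3.137) p.423, (3.126) p.420, (3.114)–(3.115) p.418; Balaban1985Variational, (28) p.282] -/
theorem tjDivRow_of_regPr_column [Fact (0 < (F.L : ℝ))] [Fact (0 < ((F.L : ℝ)⁻¹) ^ (K - n))] {ρ Θ qG : ℝ} (hρ : 0 ≤ ρ) (hΘ : 0 ≤ Θ) (hqG : 0 ≤ qG)
    (U₀ : GaugeField (F.P K) 0 (Matrix.specialUnitaryGroup (Fin 2) ℂ)) (hreg : RegPr F n K ρ U₀)
    {hk : Bond 3 (periodsT3 F K) → PBond (F.P n) 0 → ℝ}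
    (hcol : ∀ (y : PBond (F.P n) 0) (Z : Matrix (Fin 2) (Fin 2) ℂ) (b' : Bond 3 (periodsT3 F K)),
      ‖flat115 (H1f F n K h c₀ cB a (DeltaPiSlotP F n K h c₀ cB a) U₀ (Pi.single y Z)) b'‖ ≤ hk b' y * ‖Z‖)
    (hsum : ∀ y : PBond (F.P n) 0, ∑ b' : Bond 3 (periodsT3 F K), hk b' y ≤ Θ)
    (hQG : ∀ (X' : PBond (F.P K) 0 → Matrix (Fin 2) (Fin 2) ℂ) (s' : ℝ) (x : Site (F.P K) 0) (A : Matrix (Fin 2) (Fin 2) ℂ), (∀ b, ‖X' b‖ ≤ s') →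
      ∑ y : PBond (F.P n) 0, ‖avgHess F n K h U₀ X' ((toL2 F K c₀).symm (DL2 F n K c₀ U₀ (toL2S F K c₀ (Pi.single x A)))) y‖ ≤ qG * s' * ‖A‖) :
    ∀ (X : PBond (F.P K) 0 → Matrix (Fin 2) (Fin 2) ℂ) (s : ℝ), (∀ bd, ‖X bd‖ ≤ s) →
      ∀ x : Site (F.P K) 0, ‖(toL2S F K c₀).symm (DstarL2 F n K c₀ U₀ (TJSlotP F n K h c₀ cB a U₀ (toL2 F K c₀ X))) x‖ ≤ 2 * ρ * Θ * qG * (eta F n K) ^ 2 * s := by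
  intro X s hX x
  have hη : 0 < eta F n K := eta_pos F n K
  have hs : 0 ≤ s := (norm_nonneg _).trans (hX ⟨x, 0⟩)
  have hJ := norm_actionGrad_le_of_regPr (F := F) (n := n) (K := K) hρ U₀ hreg
  have hH := sum_norm_H46P_le_of_column (h := h) (c₀ := c₀) (cB := cB) (a := a) U₀ hcol hsum
  have hmain := norm_DstarL2_TJP_apply_le_of_columns (h := h) (c₀ := c₀) (cB := cB) (a := a) U₀ (cJ := (((F.L : ℝ)⁻¹) ^ (K - n)) ^ 3 * ρ) (θ := eta F n K * Θ)
    (by positivity) (by positivity) hqG hs hJ hH hQG X hX x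
  rw [TJSlotP_apply]
  calc ‖(toL2S F K c₀).symm (DstarL2 F n K c₀ U₀ (TJP F n K h c₀ cB a U₀ (toL2 F K c₀ X))) x‖
      ≤ 2 / (eta F n K) ^ 2 * ((((F.L : ℝ)⁻¹) ^ (K - n)) ^ 3 * ρ) * (eta F n K * Θ) * qG * s := hmain
    _ = 2 * ρ * Θ * qG * (eta F n K) ^ 2 * s := by
        have hdef : eta F n K = ((F.L : ℝ)⁻¹) ^ (K - n) := rfl
        rw [← hdef]
        field_simp

/-! ## §4 The family door: the divergence row of `T_Jᴾ` from `hHcol` VERBATIM and ONE displayed gauge-spike row `hqG` -/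

/-- ★★★ **THE FAMILY DOOR `hTJdiv ⟸ hHcol ∧ hqG`** — for every `L > 1`, `i : Idx L`, `U₀ ∈ 𝔘_k(α L)`, every exponent field `X` with `sup‖X‖ ≤ s` and every site `x`:
`‖(toL2S⁻¹(D*_{U₀}(T_Jᴾ(toL2 X))))(x)‖ ≤ 2·α L·ΘH L·qG L·s` — from the display's column row `hHcol` VERBATIM (the `ℓ¹`-column of print's `H` (3.126), [B9] Thm 3.12 (3.133) class; ⟸ `h133` by
✓`Prop7ColumnRowsOfKernelDecay.hHcol_of_kernel133_family`) and ONE row in supplier currency, `hqG`: the LOCAL column of the averaging Hessian `2C⁽²⁾(U₀) = avgHess U₀` against the PURE-GAUGE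
spike `D_{U₀}(toL2S(δ_x ⊗ A))`, `Σ_y ‖avgHess U₀ X′ (toL2⁻¹(D_{U₀}toL2S(δ_x ⊗ A))) y‖ ≤ qG·(L^{K−n})⁻¹·sup‖X′‖·‖A‖` — the size (q) gives a spike of size `‖A‖` (NOT the generic `η⁻¹‖A‖` of
a spike-gradient): [Balaban1985BackgroundPropagators] (3.114)–(3.115) gauge covariance of the averaging, second order (DISPLAYED; supplier: the second-order twin of
✓`Prop7SymAvgTwSGaugeDir.QTwS_gaugeDir_of_avgSeq`).  Dimension line: `(2∕η²)·(η³α)·(η·ΘH·(L^{K−n})³)·(qG·(L^{K−n})⁻¹) = 2·α·ΘH·qG` since `L^{K−n}·η = 1`.  CONDITIONAL door; nothing of the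
stub is claimed. [cite: Balaban1985BackgroundPropagators, (3.137) p.423, (3.127)–(3.128) p.421, (3.114)–(3.115) p.418, (3.126) p.420, (3.133) p.422; Balaban1985Variational, (27)–(28) p.282; Balaban1985Averaging, (157) p.42] -/
theorem hTJdiv_of_hHcol_hqG
    [hFL : ∀ F : T3Family, Fact (0 < (F.L : ℝ))] [hFη : ∀ (F : T3Family) (k : ℕ), Fact (0 < ((F.L : ℝ)⁻¹) ^ k)]
    (α ΘH qG : ℕ → ℝ) (hα : ∀ L, 1 < L → 0 < α L) (hΘH0 : ∀ L, 1 < L → 0 ≤ ΘH L) (hqG0 : ∀ L, 1 < L → 0 ≤ qG L)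
    (c₀ cB : ℕ → ℝ) [hc₀ : ∀ L : ℕ, Fact (0 < c₀ L)] [hcB : ∀ L : ℕ, Fact (0 < cB L)]
    (a : ∀ L : ℕ, Idx L → ℝ)
    (hHcol : ∀ (L : ℕ), 1 < L → ∀ (i : Idx L) (U₀ : GaugeField (i.1.1.P i.1.2.2) 0 (Matrix.specialUnitaryGroup (Fin 2) ℂ)), RegPr i.1.1 i.1.2.1 i.1.2.2 (α L) U₀ →
      ∃ hk : Bond 3 (periodsT3 i.1.1 i.1.2.2) → PBond (i.1.1.P i.1.2.1) 0 → ℝ, (∀ b' y, 0 ≤ hk b' y) ∧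
        (∀ (y : PBond (i.1.1.P i.1.2.1) 0) (Z : Matrix (Fin 2) (Fin 2) ℂ) (b' : Bond 3 (periodsT3 i.1.1 i.1.2.2)), ‖flat115 ((H1f i.1.1 i.1.2.1 i.1.2.2 i.2.2.le (c₀ L) (cB L) (a L i) (DeltaPiSlotP i.1.1 i.1.2.1 i.1.2.2 i.2.2.le (c₀ L) (cB L) (a L i)) U₀) (Pi.single y Z)) b'‖ ≤ hk b' y * ‖Z‖) ∧
        (∀ y : PBond (i.1.1.P i.1.2.1) 0, ∑ b' : Bond 3 (periodsT3 i.1.1 i.1.2.2), hk b' y ≤ ΘH L * ((L : ℝ) ^ (i.1.2.2 - i.1.2.1)) ^ 3))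
    -- ROW `hqG` — THE LOCAL COLUMN OF THE AVERAGING HESSIAN `2C⁽²⁾(U₀)` AGAINST A PURE-GAUGE SPIKE `D_{U₀}(toL2S(δ_x ⊗ A))` (supplier currency `qG·(L^{K−n})⁻¹`; DISPLAYED)
    (hqG : ∀ (L : ℕ), 1 < L → ∀ (i : Idx L) (U₀ : GaugeField (i.1.1.P i.1.2.2) 0 (Matrix.specialUnitaryGroup (Fin 2) ℂ)), RegPr i.1.1 i.1.2.1 i.1.2.2 (α L) U₀ →
      ∀ (X' : PBond (i.1.1.P i.1.2.2) 0 → Matrix (Fin 2) (Fin 2) ℂ) (s : ℝ) (x : Site (i.1.1.P i.1.2.2) 0) (A : Matrix (Fin 2) (Fin 2) ℂ), (∀ b, ‖X' b‖ ≤ s) →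
        ∑ y : PBond (i.1.1.P i.1.2.1) 0, ‖avgHess i.1.1 i.1.2.1 i.1.2.2 i.2.2.le U₀ X'
            ((toL2 i.1.1 i.1.2.2 (c₀ L)).symm (DL2 i.1.1 i.1.2.1 i.1.2.2 (c₀ L) U₀ (toL2S i.1.1 i.1.2.2 (c₀ L) (Pi.single x A)))) y‖
          ≤ qG L * ((L : ℝ) ^ (i.1.2.2 - i.1.2.1))⁻¹ * s * ‖A‖) :
    ∀ (L : ℕ), 1 < L → ∀ (i : Idx L) (U₀ : GaugeField (i.1.1.P i.1.2.2) 0 (Matrix.specialUnitaryGroup (Fin 2) ℂ)), RegPr i.1.1 i.1.2.1 i.1.2.2 (α L) U₀ →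
      ∀ (X : PBond (i.1.1.P i.1.2.2) 0 → Matrix (Fin 2) (Fin 2) ℂ) (s : ℝ), (∀ bd, ‖X bd‖ ≤ s) →
        ∀ x : Site (i.1.1.P i.1.2.2) 0,
          ‖(toL2S i.1.1 i.1.2.2 (c₀ L)).symm (DstarL2 i.1.1 i.1.2.1 i.1.2.2 (c₀ L) U₀ (TJSlotP i.1.1 i.1.2.1 i.1.2.2 i.2.2.le (c₀ L) (cB L) (a L i) U₀ (toL2 i.1.1 i.1.2.2 (c₀ L) X))) x‖ ≤
          2 * α L * ΘH L * qG L * s := by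
  intro L hL i U₀ hU X s hX x
  obtain ⟨hk, -, hcol, hsum⟩ := hHcol L hL i U₀ hU
  have hLpos : (0 : ℝ) < L := by exact_mod_cast (zero_lt_one.trans hL)
  have hM : (0 : ℝ) < (L : ℝ) ^ (i.1.2.2 - i.1.2.1) := pow_pos hLpos _
  have hΘ := hΘH0 L hL
  have hq := hqG0 L hL
  have hrow := tjDivRow_of_regPr_column (h := i.2.2.le) (c₀ := c₀ L) (cB := cB L) (a := a L i) (hα L hL).le (by positivity : 0 ≤ ΘH L * ((L : ℝ) ^ (i.1.2.2 - i.1.2.1)) ^ 3)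
    (by positivity : 0 ≤ qG L * ((L : ℝ) ^ (i.1.2.2 - i.1.2.1))⁻¹) U₀ hU hcol hsum (hqG L hL i U₀ hU) X s hX x
  have hη : eta i.1.1 i.1.2.1 i.1.2.2 = ((L : ℝ) ^ (i.1.2.2 - i.1.2.1))⁻¹ := by
    have hLi : (i.1.1.L : ℝ) = (L : ℝ) := by exact_mod_cast i.2.1
    show ((i.1.1.L : ℝ)⁻¹) ^ (i.1.2.2 - i.1.2.1) = _
    rw [hLi, inv_pow]
  rw [hη] at hrow
  calc ‖(toL2S i.1.1 i.1.2.2 (c₀ L)).symm (DstarL2 i.1.1 i.1.2.1 i.1.2.2 (c₀ L) U₀ (TJSlotP i.1.1 i.1.2.1 i.1.2.2 i.2.2.le (c₀ L) (cB L) (a L i) U₀ (toL2 i.1.1 i.1.2.2 (c₀ L) X))) x‖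
      ≤ 2 * α L * (ΘH L * ((L : ℝ) ^ (i.1.2.2 - i.1.2.1)) ^ 3) * (qG L * ((L : ℝ) ^ (i.1.2.2 - i.1.2.1))⁻¹) * (((L : ℝ) ^ (i.1.2.2 - i.1.2.1))⁻¹) ^ 2 * s := hrow
    _ = 2 * α L * ΘH L * qG L * s := by field_simp

end Summit.QuantumFields.YangMills.Theorems.Prop7TJDivRowOfColumns

end
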